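import Literature.NumberTheory.Automorphic.RestrictedProductBoxes
import Literature.NumberTheory.Automorphic.HeckeGelfandTrick
import HarnessLib

/-!
# Hecke operators of a box subgroup of a restricted product: centraliser translation, one place, and the product over
# the places where the local Hecke operators act by scalars

Topic `NumberTheory/Automorphic`; namespace `Literature.NumberTheory.Automorphic`.  THEOREMS ONLY (no definition, no named
fact, no instance) over Mathlib's `RestrictedProduct` `Γ = Πʳ i, [G i, K i]` (cofinite filter), the tree's coordinate embeddings
`ι_i = mulSingleHom K i` and box subgroups `C = boxSubgroup L = ∏ L_i` (`RestrictedProductBoxes`), and the tree's concrete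
Hecke operators `[CγC] = ∑_{yC ⊆ CγC} π(y)` on `C`-fixed vectors (`HeckeAlgebra`, `HeckeGelfandTrick`).

§1 (any group). `heckeOperator_apply_mul_of_centralizer`: if `g₀` centralises `K` then `[K (g₀γ) K] v = π(g₀) ([KγK] v)`
on `V^K`, and `K (g₀γ) K / K` is finite when `K γ K / K` is.

§2 (restricted products). For a box `C = ∏ L_i`:
* `bijOn_image_mulSingle_orbit_boxSubgroup`, `heckeOperator_boxSubgroup_mulSingle_apply` — ONE PLACE: a transversal of
  `L_i a L_i / L_i` maps under `ι_i` to a transversal of `C ι_i(a) C / C`, so `[C ι_i(a) C] w = [L_i a L_i] w` (the local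
  Hecke operator of `π ∘ ι_i`) for `w ∈ W^C`.
* `exists_transversal_boxSubgroup_smul` — THE PRODUCT: if at every place `i ∉ S` the local Hecke operators `[L_i a L_i]` act
  on the `L_i`-fixed vectors of `π ∘ ι_i` by scalars `c i a`, then for every `γ` with `γ_j ∈ L_j` at the places `j ∈ S` the
  double coset `C γ C` has a finite transversal SUPPORTED on `T = {i ∉ S | γ_i ∉ L_i}` and `[CγC]` acts on `W^C` by
  `∏_{i ∈ T} c i (γ_i)` (induction on `T`: `C ι_i(a)β C / C = (C ι_i(a) C / C) · (C β C / C)` for `β_i = 1`, Flath's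
  `ℋ(G, C) ≅ ⊗'_i ℋ(G_i, L_i)` read on operators).
* `heckeOperator_boxSubgroup_apply_eq_smul` — with the places `j ∈ S` carrying TRIVIAL sides `L_j = ⊥`, EVERY `γ ∈ Γ` splits
  as `g₀ γ°` with `g₀` supported on `S` (centralising `C`) and `[CγC] w = (∏_{i ∈ T} c i (γ_i)) • π(g₀) w` on `W^C`; and every
  `C γ C / C` is finite (`finite_orbit_boxSubgroup`) — the Hecke-pair condition for the compact, non-open `K^S = ∏_{j ∉ S} K_j`.
These are the unramified bookkeeping of Flath 1979 (§2 Example 2, Thm. 2: `ℋ(G,K) = ⊗' ℋ(G_v, K_v)` with respect to the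
idempotents `e_{K_v}`) and of Bump 1997, §3.4 (pp. 314–315), stated on `C`-fixed vectors so that NO commutativity of the local
Hecke algebras is assumed: only that they ACT BY SCALARS on the given representation at the places outside `S`.

## References
* D. Flath, *Decomposition of representations into tensor products*, PSPM 33.1 (1979), §2 Example 2, Thm. 2.
* D. Bump, *Automorphic Forms and Representations* (1997), §3.4, Thm. 3.4.4; Prop. 4.2.3.
-/

set_option autoImplicit false

noncomputable section

open MulAction
open scoped RestrictedProduct

namespace Literature.NumberTheory.Automorphic

/-! ## §1 Translation by an element centralising `K` -/

section Centralizer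

variable {k : Type*} [CommRing k] {Γ : Type*} [Group Γ] {V : Type*} [AddCommGroup V] [Module k V]
  (ρ : Representation k Γ V) (K : Subgroup Γ)

/-- A finite `K`-orbit in `Γ ⧸ K` has a finite transversal in `Γ` (its `Quotient.out` representatives) — the finite sum
form of `[KγK]` (Bump 1997, §4.2 before Prop. 4.2.3). [cite: Bump1997, Prop. 4.2.3] -/
theorem exists_transversal_of_finite_orbit {γ : Γ} (hfin : (orbit K (γ : Γ ⧸ K)).Finite) :
    ∃ s : Finset Γ, Set.BijOn (fun x : Γ => (x : Γ ⧸ K)) s (orbit K (γ : Γ ⧸ K)) := by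
  classical
  refine ⟨hfin.toFinset.image Quotient.out, ?_, ?_, ?_⟩
  · intro x hx
    obtain ⟨y, hy, rfl⟩ := Finset.mem_image.1 (Finset.mem_coe.1 hx)
    change (y.out : Γ ⧸ K) ∈ _
    rw [QuotientGroup.out_eq']
    exact hfin.mem_toFinset.1 hy
  · intro x hx x' hx' h
    obtain ⟨y, -, rfl⟩ := Finset.mem_image.1 (Finset.mem_coe.1 hx)
    obtain ⟨y', -, rfl⟩ := Finset.mem_image.1 (Finset.mem_coe.1 hx')
    change (y.out : Γ ⧸ K) = (y'.out : Γ ⧸ K) at h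
    rw [QuotientGroup.out_eq', QuotientGroup.out_eq'] at h
    rw [h]
  · intro y hy
    exact ⟨y.out, Finset.mem_coe.2 (Finset.mem_image.2 ⟨y, hfin.mem_toFinset.2 hy, rfl⟩), QuotientGroup.out_eq' y⟩

/-- **Translation by a centralising element.**  If `g₀` commutes with every element of `K` and `s` is a transversal of
`K γ K / K`, then `g₀ • s` is a transversal of `K (g₀ γ) K / K`. [cite: Bump1997, Prop. 4.2.3] -/
theorem bijOn_image_mul_left_of_centralizer [DecidableEq Γ] {g₀ : Γ} (hg₀ : ∀ c ∈ K, g₀ * c = c * g₀) (γ : Γ)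
    {s : Finset Γ} (hs : Set.BijOn (fun x : Γ => (x : Γ ⧸ K)) s (orbit K (γ : Γ ⧸ K))) :
    Set.BijOn (fun x : Γ => (x : Γ ⧸ K)) (s.image (g₀ * ·)) (orbit K ((g₀ * γ : Γ) : Γ ⧸ K)) := by
  refine ⟨?_, ?_, ?_⟩
  · intro x hx
    obtain ⟨y, hy, rfl⟩ := Finset.mem_image.1 (Finset.mem_coe.1 hx)
    obtain ⟨κ, hκ⟩ := mem_orbit_iff.1 (hs.1 (Finset.mem_coe.2 hy))
    refine mem_orbit_iff.2 ⟨κ, ?_⟩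
    change (((κ : Γ) * (g₀ * γ) : Γ) : Γ ⧸ K) = ((g₀ * y : Γ) : Γ ⧸ K)
    have hκ' : (((κ : Γ) * γ : Γ) : Γ ⧸ K) = (y : Γ ⧸ K) := hκ
    rw [← mul_assoc, ← hg₀ κ κ.2, mul_assoc, QuotientGroup.eq] at *
    simpa [mul_assoc] using hκ'
  · intro x hx x' hx' h
    obtain ⟨y, hy, rfl⟩ := Finset.mem_image.1 (Finset.mem_coe.1 hx)
    obtain ⟨y', hy', rfl⟩ := Finset.mem_image.1 (Finset.mem_coe.1 hx')
    have h' : (y : Γ ⧸ K) = (y' : Γ ⧸ K) := by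
      change ((g₀ * y : Γ) : Γ ⧸ K) = ((g₀ * y' : Γ) : Γ ⧸ K) at h
      rw [QuotientGroup.eq] at h ⊢
      simpa [mul_assoc] using h
    rw [hs.2.1 (Finset.mem_coe.2 hy) (Finset.mem_coe.2 hy') h']
  · intro z hz
    obtain ⟨κ, rfl⟩ := mem_orbit_iff.1 hz
    have hmem : (((κ : Γ) * γ : Γ) : Γ ⧸ K) ∈ orbit K (γ : Γ ⧸ K) := mem_orbit_iff.2 ⟨κ, rfl⟩
    obtain ⟨y, hy, hyeq⟩ := hs.2.2 hmem
    refine ⟨g₀ * y, Finset.mem_coe.2 (Finset.mem_image.2 ⟨y, Finset.mem_coe.1 hy, rfl⟩), ?_⟩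
    change ((g₀ * y : Γ) : Γ ⧸ K) = (((κ : Γ) * (g₀ * γ) : Γ) : Γ ⧸ K)
    have hyeq' : (y : Γ ⧸ K) = (((κ : Γ) * γ : Γ) : Γ ⧸ K) := hyeq
    rw [← mul_assoc, ← hg₀ κ κ.2, mul_assoc, QuotientGroup.eq] at *
    simpa [mul_assoc] using hyeq'

/-- If `g₀` centralises `K` then `K (g₀γ) K / K` is finite as soon as `K γ K / K` is. [cite: Bump1997, Prop. 4.2.3] -/
theorem finite_orbit_mul_left_of_centralizer {g₀ : Γ} (hg₀ : ∀ c ∈ K, g₀ * c = c * g₀) {γ : Γ}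
    (hfin : (orbit K (γ : Γ ⧸ K)).Finite) : (orbit K ((g₀ * γ : Γ) : Γ ⧸ K)).Finite := by
  classical
  obtain ⟨s, hs⟩ := exists_transversal_of_finite_orbit K hfin
  rw [← (bijOn_image_mul_left_of_centralizer K hg₀ γ hs).image_eq]
  exact (Finset.finite_toSet _).image _

/-- **`[K (g₀γ) K] v = π(g₀) ([KγK] v)` on `V^K` for `g₀` centralising `K`** (left translation of the transversal).
[cite: Bump1997, Prop. 4.2.3] -/
theorem heckeOperator_apply_mul_of_centralizer {g₀ : Γ} (hg₀ : ∀ c ∈ K, g₀ * c = c * g₀) (γ : Γ)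
    (hfin : (orbit K (γ : Γ ⧸ K)).Finite) {v : V} (hv : v ∈ ρ.fixedPoints K) :
    heckeOperator ρ K (g₀ * γ) v = ρ g₀ (heckeOperator ρ K γ v) := by
  classical
  obtain ⟨s, hs⟩ := exists_transversal_of_finite_orbit K hfin
  rw [heckeOperator_apply_eq_sum ρ K γ s hs hv,
    heckeOperator_apply_eq_sum ρ K (g₀ * γ) _ (bijOn_image_mul_left_of_centralizer K hg₀ γ hs) hv,
    Finset.sum_image (fun x _ y _ h => mul_left_cancel h), map_sum]
  simp only [map_mul, Module.End.mul_apply]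

end Centralizer

/-! ## §2 Box subgroups of a restricted product -/

section Box

universe u v

variable {ι : Type u} {G : ι → Type v} [∀ i, Group (G i)] {K : ∀ i, Subgroup (G i)} [DecidableEq ι]
variable {k : Type*} [CommRing k] {W : Type*} [AddCommGroup W] [Module k W]
variable (π : Representation k (Πʳ i, [G i, K i]) W) (L : ∀ i, Subgroup (G i))

omit [DecidableEq ι] in
/-- `γ C = γ' C` for the box `C = ∏ L_i` iff `γ_j⁻¹ γ'_j ∈ L_j` at every place (coordinatewise membership). [folklore] -/
private theorem mk_boxSubgroup_eq_iff (γ γ' : Πʳ i, [G i, K i]) :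
    ((γ : (Πʳ i, [G i, K i]) ⧸ boxSubgroup (K := K) L) = (γ' : (Πʳ i, [G i, K i]) ⧸ boxSubgroup (K := K) L)) ↔
      ∀ j, (γ j)⁻¹ * γ' j ∈ L j := by
  rw [QuotientGroup.eq, mem_boxSubgroup_iff]
  simp only [RestrictedProduct.mul_apply, RestrictedProduct.inv_apply]

/-- **One place: transversals.**  A transversal `s` of `L_i a L_i / L_i` in `G_i` maps under `ι_i` to a transversal of
`C ι_i(a) C / C` for the box `C = ∏ L_j` (Flath 1979, §2 Example 2: `C ι_i(a) C = ι_i(L_i a L_i) · C`).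
[cite: FlathCorvallis1979, §2 Example 2] -/
theorem bijOn_image_mulSingle_orbit_boxSubgroup [DecidableEq (Πʳ i, [G i, K i])] (i : ι) (a : G i) {s : Finset (G i)}
    (hs : Set.BijOn (fun x : G i => (x : G i ⧸ L i)) s (orbit (L i) (a : G i ⧸ L i))) :
    Set.BijOn (fun x : Πʳ i, [G i, K i] => (x : (Πʳ i, [G i, K i]) ⧸ boxSubgroup (K := K) L))
      (s.image (RestrictedProduct.mulSingle K i))
      (orbit (boxSubgroup (K := K) L) (RestrictedProduct.mulSingle K i a : (Πʳ i, [G i, K i]) ⧸ boxSubgroup (K := K) L)) := by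
  classical
  -- cosets of `ι_i x` and `ι_i x'` agree iff `x L_i = x' L_i`
  have hmk : ∀ x x' : G i, ((RestrictedProduct.mulSingle K i x : Πʳ i, [G i, K i]) :
        (Πʳ i, [G i, K i]) ⧸ boxSubgroup (K := K) L) = (RestrictedProduct.mulSingle K i x' : Πʳ i, [G i, K i]) ↔
      (x : G i ⧸ L i) = (x' : G i ⧸ L i) := fun x x' => by
    rw [mk_boxSubgroup_eq_iff, QuotientGroup.eq]
    refine ⟨fun h => by simpa using h i, fun h j => ?_⟩
    by_cases hj : j = i
    · subst hj; simpa using h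
    · simp [Pi.mulSingle_eq_of_ne hj, (L j).one_mem]
  refine ⟨?_, ?_, ?_⟩
  · intro x hx
    obtain ⟨y, hy, rfl⟩ := Finset.mem_image.1 (Finset.mem_coe.1 hx)
    obtain ⟨l, hl⟩ := mem_orbit_iff.1 (hs.1 (Finset.mem_coe.2 hy))
    refine mem_orbit_iff.2 ⟨⟨RestrictedProduct.mulSingle K i (l : G i), mulSingle_mem_boxSubgroup_iff.2 l.2⟩, ?_⟩
    change (((RestrictedProduct.mulSingle K i (l : G i)) * RestrictedProduct.mulSingle K i a : Πʳ i, [G i, K i]) :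
        (Πʳ i, [G i, K i]) ⧸ boxSubgroup (K := K) L) = _
    rw [← RestrictedProduct.mulSingle_mul, hmk]
    exact hl
  · intro x hx x' hx' h
    obtain ⟨y, hy, rfl⟩ := Finset.mem_image.1 (Finset.mem_coe.1 hx)
    obtain ⟨y', hy', rfl⟩ := Finset.mem_image.1 (Finset.mem_coe.1 hx')
    rw [hs.2.1 (Finset.mem_coe.2 hy) (Finset.mem_coe.2 hy') ((hmk y y').1 h)]
  · intro z hz
    obtain ⟨c, rfl⟩ := mem_orbit_iff.1 hz
    -- `c ι_i(a) C = ι_i(c_i a) C`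
    have hci : (c : Πʳ i, [G i, K i]) i ∈ L i := c.2 i
    have hmem : (((c : Πʳ i, [G i, K i]) i * a : G i) : G i ⧸ L i) ∈ orbit (L i) (a : G i ⧸ L i) :=
      mem_orbit_iff.2 ⟨⟨_, hci⟩, rfl⟩
    obtain ⟨y, hy, hyeq⟩ := hs.2.2 hmem
    refine ⟨RestrictedProduct.mulSingle K i y, Finset.mem_coe.2 (Finset.mem_image.2 ⟨y, Finset.mem_coe.1 hy, rfl⟩), ?_⟩
    change ((RestrictedProduct.mulSingle K i y : Πʳ i, [G i, K i]) : (Πʳ i, [G i, K i]) ⧸ boxSubgroup (K := K) L) =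
      (((c : Πʳ i, [G i, K i]) * RestrictedProduct.mulSingle K i a : Πʳ i, [G i, K i]) : _ ⧸ boxSubgroup (K := K) L)
    rw [mk_boxSubgroup_eq_iff]
    intro j
    have hyeq' : (y : G i ⧸ L i) = (((c : Πʳ i, [G i, K i]) i * a : G i) : G i ⧸ L i) := hyeq
    rw [QuotientGroup.eq] at hyeq'
    by_cases hj : j = i
    · subst hj
      simpa [RestrictedProduct.mul_apply] using hyeq'
    · simp only [RestrictedProduct.mul_apply, RestrictedProduct.coe_mulSingle_apply, Pi.mulSingle_eq_of_ne hj, inv_one,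
        one_mul, mul_one]
      exact c.2 j

/-- **One place: the Hecke operator.**  For `w ∈ W^C`, `C = ∏ L_j`, and `L_i a L_i / L_i` finite:
`[C ι_i(a) C] w = [L_i a L_i] w`, the local Hecke operator of `π ∘ ι_i`. [cite: FlathCorvallis1979, §2 Example 2] -/
theorem heckeOperator_boxSubgroup_mulSingle_apply (i : ι) (a : G i) (hfin : (orbit (L i) (a : G i ⧸ L i)).Finite) {w : W}
    (hw : w ∈ π.fixedPoints (boxSubgroup (K := K) L)) :
    heckeOperator π (boxSubgroup (K := K) L) (RestrictedProduct.mulSingle K i a) w =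
      heckeOperator (π.comp (mulSingleHom K i)) (L i) a w := by
  classical
  obtain ⟨s, hs⟩ := exists_transversal_of_finite_orbit (L i) hfin
  have hw' : w ∈ Representation.fixedPoints (π.comp (mulSingleHom K i)) (L i) := by
    rw [Representation.mem_fixedPoints]
    intro l hl
    exact (π.mem_fixedPoints _ w).1 hw _ (mulSingle_mem_boxSubgroup_iff.2 hl)
  rw [heckeOperator_apply_eq_sum _ _ _ _ (bijOn_image_mulSingle_orbit_boxSubgroup L i a hs) hw,
    heckeOperator_apply_eq_sum _ _ _ _ hs hw',
    Finset.sum_image (fun x _ y _ h => RestrictedProduct.mulSingle_injective K i h)]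
  rfl

/-- Finiteness of `C ι_i(a) C / C` from that of `L_i a L_i / L_i`. [cite: FlathCorvallis1979, §2 Example 2] -/
theorem finite_orbit_boxSubgroup_mulSingle (i : ι) (a : G i) (hfin : (orbit (L i) (a : G i ⧸ L i)).Finite) :
    (orbit (boxSubgroup (K := K) L)
      (RestrictedProduct.mulSingle K i a : (Πʳ i, [G i, K i]) ⧸ boxSubgroup (K := K) L)).Finite := by
  classical
  obtain ⟨s, hs⟩ := exists_transversal_of_finite_orbit (L i) hfin
  rw [← (bijOn_image_mulSingle_orbit_boxSubgroup L i a hs).image_eq]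
  exact (Finset.finite_toSet _).image _

/-- **Two commuting places: product of transversals.**  For the box `C = ∏ L_j`, a transversal `s₁ ⊆ ι_i(G_i)` of
`C ι_i(a) C / C` and a transversal `s₂` of `C β C / C` consisting of elements with trivial `i`-th coordinate, where `β_i = 1`:
the products `x y` (`x ∈ s₁`, `y ∈ s₂`) form a transversal of `C ι_i(a)β C / C`, and `(x, y) ↦ x y` is injective. (Flath 1979,
§2 Example 2 ∕ Thm. 2: `ℋ(G, C) ≅ ⊗' ℋ(G_v, L_v)` — the double cosets of a box multiply coordinatewise.)
[cite: FlathCorvallis1979, Thm. 2] -/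
theorem bijOn_image_mul_orbit_boxSubgroup [DecidableEq (Πʳ i, [G i, K i])] (i : ι) (a : G i) (β γ : Πʳ i, [G i, K i])
    (hβ : β i = 1) (hγ : RestrictedProduct.mulSingle K i a * β = γ)
    {s₁ : Finset (G i)} (hs₁ : Set.BijOn (fun x : G i => (x : G i ⧸ L i)) s₁ (orbit (L i) (a : G i ⧸ L i)))
    {s₂ : Finset (Πʳ i, [G i, K i])} (hs₂i : ∀ y ∈ s₂, y i = 1)
    (hs₂ : Set.BijOn (fun x : Πʳ i, [G i, K i] => (x : (Πʳ i, [G i, K i]) ⧸ boxSubgroup (K := K) L)) s₂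
      (orbit (boxSubgroup (K := K) L) (β : (Πʳ i, [G i, K i]) ⧸ boxSubgroup (K := K) L))) :
    Set.InjOn (fun p : G i × Πʳ i, [G i, K i] => RestrictedProduct.mulSingle K i p.1 * p.2) (s₁ ×ˢ s₂ : Finset _) ∧
    Set.BijOn (fun x : Πʳ i, [G i, K i] => (x : (Πʳ i, [G i, K i]) ⧸ boxSubgroup (K := K) L))
      ((s₁ ×ˢ s₂).image fun p => RestrictedProduct.mulSingle K i p.1 * p.2)
      (orbit (boxSubgroup (K := K) L) (γ : (Πʳ i, [G i, K i]) ⧸ boxSubgroup (K := K) L)) := by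
  classical
  subst hγ
  -- coordinates of a product `ι_i(x) y` with `y_i = 1`
  have hcoord_i : ∀ (x : G i) (y : Πʳ i, [G i, K i]), y i = 1 → (RestrictedProduct.mulSingle K i x * y) i = x := fun x y hy => by
    simp [RestrictedProduct.mul_apply, hy]
  have hcoord_j : ∀ (x : G i) (y : Πʳ i, [G i, K i]) {j : ι}, j ≠ i → (RestrictedProduct.mulSingle K i x * y) j = y j :=
    fun x y j hj => by simp [RestrictedProduct.mul_apply, Pi.mulSingle_eq_of_ne hj]
  -- the key: cosets of products agree iff both factors' cosets agree
  have hiff : ∀ x x' : G i, ∀ y y' : Πʳ i, [G i, K i], y i = 1 → y' i = 1 →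
      (((RestrictedProduct.mulSingle K i x * y : Πʳ i, [G i, K i]) : (Πʳ i, [G i, K i]) ⧸ boxSubgroup (K := K) L) =
        (RestrictedProduct.mulSingle K i x' * y' : Πʳ i, [G i, K i]) ↔
      (x : G i ⧸ L i) = (x' : G i ⧸ L i) ∧
        ((y : (Πʳ i, [G i, K i]) ⧸ boxSubgroup (K := K) L) = (y' : (Πʳ i, [G i, K i]) ⧸ boxSubgroup (K := K) L))) := by
    intro x x' y y' hy hy'
    rw [mk_boxSubgroup_eq_iff, mk_boxSubgroup_eq_iff, QuotientGroup.eq]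
    constructor
    · intro h
      refine ⟨by simpa [hcoord_i x y hy, hcoord_i x' y' hy'] using h i, fun j => ?_⟩
      by_cases hj : j = i
      · subst hj; simp [hy, hy', (L j).one_mem]
      · simpa [hcoord_j x y hj, hcoord_j x' y' hj] using h j
    · rintro ⟨hx, hyy⟩ j
      by_cases hj : j = i
      · subst hj; simpa [hcoord_i x y hy, hcoord_i x' y' hy'] using hx
      · simpa [hcoord_j x y hj, hcoord_j x' y' hj] using hyy j
  have hinj' : ∀ p ∈ (s₁ ×ˢ s₂ : Finset _), ∀ p' ∈ (s₁ ×ˢ s₂ : Finset _),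
      ((RestrictedProduct.mulSingle K i p.1 * p.2 : Πʳ i, [G i, K i]) : (Πʳ i, [G i, K i]) ⧸ boxSubgroup (K := K) L) =
        (RestrictedProduct.mulSingle K i p'.1 * p'.2 : Πʳ i, [G i, K i]) → p = p' := by
    rintro ⟨x, y⟩ hxy ⟨x', y'⟩ hxy' h
    obtain ⟨hx, hy⟩ := Finset.mem_product.1 hxy
    obtain ⟨hx', hy'⟩ := Finset.mem_product.1 hxy'
    have h' := (hiff x x' y y' (hs₂i y hy) (hs₂i y' hy')).1 h
    rw [Prod.mk.injEq]
    exact ⟨hs₁.2.1 (Finset.mem_coe.2 hx) (Finset.mem_coe.2 hx') h'.1,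
      hs₂.2.1 (Finset.mem_coe.2 hy) (Finset.mem_coe.2 hy') h'.2⟩
  have hinj : Set.InjOn (fun p : G i × Πʳ i, [G i, K i] => RestrictedProduct.mulSingle K i p.1 * p.2) (s₁ ×ˢ s₂ : Finset _) :=
    fun p hp p' hp' h => hinj' p (Finset.mem_coe.1 hp) p' (Finset.mem_coe.1 hp') (congrArg _ h)
  refine ⟨hinj, ?_, ?_, ?_⟩
  · -- products land in the orbit of `ι_i(a) β`
    intro z hz
    obtain ⟨⟨x, y⟩, hxy, rfl⟩ := Finset.mem_image.1 (Finset.mem_coe.1 hz)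
    obtain ⟨hx, hy⟩ := Finset.mem_product.1 hxy
    obtain ⟨l, hl⟩ := mem_orbit_iff.1 (hs₁.1 (Finset.mem_coe.2 hx))
    obtain ⟨c, hc⟩ := mem_orbit_iff.1 (hs₂.1 (Finset.mem_coe.2 hy))
    -- `c' := c · ι_i(c_i)⁻¹ ∈ C` has trivial `i`-th coordinate; the element `ι_i(l) c'` of `C` carries `ι_i(a) β` to `ι_i(x) y`
    have hl' : (((l : G i) * a : G i) : G i ⧸ L i) = (x : G i ⧸ L i) := hl
    have hc' : (((c : Πʳ i, [G i, K i]) * β : Πʳ i, [G i, K i]) : (Πʳ i, [G i, K i]) ⧸ boxSubgroup (K := K) L) = y := hc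
    rw [QuotientGroup.eq] at hl'
    rw [mk_boxSubgroup_eq_iff] at hc'
    refine mem_orbit_iff.2 ⟨⟨RestrictedProduct.mulSingle K i (l : G i) *
        ((c : Πʳ i, [G i, K i]) * (RestrictedProduct.mulSingle K i ((c : Πʳ i, [G i, K i]) i))⁻¹), ?_⟩, ?_⟩
    · exact (boxSubgroup L).mul_mem (mulSingle_mem_boxSubgroup_iff.2 l.2)
        ((boxSubgroup L).mul_mem c.2 ((boxSubgroup L).inv_mem (mulSingle_mem_boxSubgroup_iff.2 (c.2 i))))
    · change ((((RestrictedProduct.mulSingle K i (l : G i) *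
          ((c : Πʳ i, [G i, K i]) * (RestrictedProduct.mulSingle K i ((c : Πʳ i, [G i, K i]) i))⁻¹)) *
          (RestrictedProduct.mulSingle K i a * β) : Πʳ i, [G i, K i])) : (Πʳ i, [G i, K i]) ⧸ boxSubgroup (K := K) L) =
        (RestrictedProduct.mulSingle K i x * y : Πʳ i, [G i, K i])
      rw [mk_boxSubgroup_eq_iff]
      intro j
      by_cases hj : j = i
      · subst hj
        have := hcoord_i x y (hs₂i y hy)
        simp only [RestrictedProduct.mul_apply, RestrictedProduct.inv_apply, RestrictedProduct.coe_mulSingle_apply,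
          Pi.mulSingle_eq_same, hβ, hs₂i y hy, mul_one]
        simpa [mul_assoc, mul_inv_rev] using hl'
      · have h1 := hc' j
        simp only [RestrictedProduct.mul_apply, RestrictedProduct.inv_apply, RestrictedProduct.coe_mulSingle_apply,
          Pi.mulSingle_eq_of_ne hj, one_mul, inv_one, mul_one] at h1 ⊢
        exact h1
  · intro z hz z' hz' h
    obtain ⟨p, hp, rfl⟩ := Finset.mem_image.1 (Finset.mem_coe.1 hz)
    obtain ⟨p', hp', rfl⟩ := Finset.mem_image.1 (Finset.mem_coe.1 hz')
    rw [hinj' p hp p' hp' h]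
  · -- every coset of the orbit is reached
    intro z hz
    obtain ⟨c, rfl⟩ := mem_orbit_iff.1 hz
    -- the `i`-th factor
    have hmem₁ : (((c : Πʳ i, [G i, K i]) i * a : G i) : G i ⧸ L i) ∈ orbit (L i) (a : G i ⧸ L i) :=
      mem_orbit_iff.2 ⟨⟨_, c.2 i⟩, rfl⟩
    obtain ⟨x, hx, hxeq⟩ := hs₁.2.2 hmem₁
    -- the complementary factor `c' β`, `c' = c ι_i(c_i)⁻¹`
    set c' : Πʳ i, [G i, K i] := (c : Πʳ i, [G i, K i]) * (RestrictedProduct.mulSingle K i ((c : Πʳ i, [G i, K i]) i))⁻¹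
      with hc'def
    have hc'C : c' ∈ boxSubgroup (K := K) L :=
      (boxSubgroup L).mul_mem c.2 ((boxSubgroup L).inv_mem (mulSingle_mem_boxSubgroup_iff.2 (c.2 i)))
    have hmem₂ : ((c' * β : Πʳ i, [G i, K i]) : (Πʳ i, [G i, K i]) ⧸ boxSubgroup (K := K) L) ∈
        orbit (boxSubgroup (K := K) L) (β : (Πʳ i, [G i, K i]) ⧸ boxSubgroup (K := K) L) :=
      mem_orbit_iff.2 ⟨⟨c', hc'C⟩, rfl⟩
    obtain ⟨y, hy, hyeq⟩ := hs₂.2.2 hmem₂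
    refine ⟨RestrictedProduct.mulSingle K i x * y,
      Finset.mem_coe.2 (Finset.mem_image.2 ⟨(x, y), Finset.mem_product.2 ⟨Finset.mem_coe.1 hx, Finset.mem_coe.1 hy⟩, rfl⟩), ?_⟩
    change ((RestrictedProduct.mulSingle K i x * y : Πʳ i, [G i, K i]) : (Πʳ i, [G i, K i]) ⧸ boxSubgroup (K := K) L) =
      (((c : Πʳ i, [G i, K i]) * (RestrictedProduct.mulSingle K i a * β) : Πʳ i, [G i, K i]) : _ ⧸ boxSubgroup (K := K) L)
    have hxeq' : (x : G i ⧸ L i) = (((c : Πʳ i, [G i, K i]) i * a : G i) : G i ⧸ L i) := hxeq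
    have hyeq' : (y : (Πʳ i, [G i, K i]) ⧸ boxSubgroup (K := K) L) = ((c' * β : Πʳ i, [G i, K i]) : _) := hyeq
    rw [QuotientGroup.eq] at hxeq'
    rw [mk_boxSubgroup_eq_iff] at hyeq' ⊢
    intro j
    by_cases hj : j = i
    · subst hj
      simp only [RestrictedProduct.mul_apply, RestrictedProduct.coe_mulSingle_apply, Pi.mulSingle_eq_same, hβ,
        hs₂i y hy, mul_one]
      exact hxeq'
    · have h1 := hyeq' j
      simp only [hc'def, RestrictedProduct.mul_apply, RestrictedProduct.inv_apply, RestrictedProduct.coe_mulSingle_apply,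
        Pi.mulSingle_eq_of_ne hj, one_mul, inv_one, mul_one] at h1 ⊢
      exact h1

end Box

end Literature.NumberTheory.Automorphic

end
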